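import Summits.MatrixMultiplication.MatrixMultiplication.Theorems.FidelityWitnessesLinearDefectLawSlotDeflation
import Literature.Computability.AlgebraicComplexity.AlderStrassen

/-!
# `FidelityWitnesses.LinearDefectLaw` (stmt-MatrixMultiplication-14039) — slot deflation, II: two deficient slots in any
# position, sums of triads, and the reduction of the rank-4 rung `M(2,4) ≤ 5` to the doubly-concise stratum

Sequel of `…LinearDefectLawSlotDeflation` (the projection calculus and the `(a,b)` case).  Here:

* the slot pairs `(a,c)` and `(b,c)` (`overlap_sq_le_five_of_annihilated_ac/bc`; the double contractions of `⟨2,2,2⟩` are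
  again `2 × 2` matrix products, bounded by Cauchy–Schwarz);
* sums of ANY number of triads whose factor families are annihilated by unit functionals in two of the three slots
  (`overlap_sq_le_five_of_two_deficient`);
* when a factor family is deficient: fewer than `4 = dim ℂ^{2×2}` vectors (`deficient_of_card_lt`, rank–nullity), or four
  linearly dependent ones (`deficient_of_not_linearIndependent`);
* consequences: `M(2,3) ≤ 5` unconditionally (`overlap_sq_le_five_of_rank_le_three`; the law's rank-3 rung asks for `4`),
  the rank-4 rung on every decomposition with two dependent factor families (`rung24_of_two_dependent`), and the
  REDUCTION `rung24_of_doublyConcise` (registered stub `stub_rung24OfDoublyConcise`): the third conjunct `M(2,4) ≤ 5` of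
  `TwoIff.lawAtTwo_iff` follows from its instances on sums of four triads whose factor families are BASES of `ℂ^{2×2}` in at
  least two slots — the generic, doubly-concise stratum, where the supremum `3 + √2` of `Rung24.rung24_ge` lives.
-/

noncomputable section

namespace Summit.MatrixMultiplication.MatrixMultiplication.Theorems.LinearDefectLaw.SlotDeflation

open scoped BigOperators ComplexConjugate
open Literature.Computability.AlgebraicComplexity
open Summit.MatrixMultiplication.MatrixMultiplication.Theorems.LinearDefectLaw.Reduction
  (P overlap normSq normSq_nonneg)

set_option linter.dupNamespace false

/-! ## The `(a,c)` and `(b,c)` double contractions of `⟨2,2,2⟩` -/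

/-- The `(a,c)`-double contraction of `T₂`: `Σ_b ‖Σ_a conj(α a) cC γ T₂ a b‖² ≤ ‖α‖²‖γ‖²` (Cauchy–Schwarz over `ν`). -/
theorem sum_norm_cAC_T₂_le (α γ : P 2 → ℂ) :
    ∑ b, ‖∑ a, conj (α a) * cC γ T₂ a b‖ ^ 2 ≤ (∑ a, ‖α a‖ ^ 2) * ∑ c, ‖γ c‖ ^ 2 := by
  simp only [cC_T₂, Fintype.sum_prod_type, Fin.sum_univ_two, Fin.isValue]
  simp only [Fin.isValue, ↓reduceIte, Fin.one_eq_zero_iff, OfNat.ofNat_ne_one, Fin.zero_eq_one_iff,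
    mul_zero, add_zero, zero_add]
  have h00 := norm_add_mul_sq_le (conj (α (0, 0))) (conj (γ (0, 0))) (conj (α (0, 1))) (conj (γ (0, 1)))
  have h01 := norm_add_mul_sq_le (conj (α (0, 0))) (conj (γ (1, 0))) (conj (α (0, 1))) (conj (γ (1, 1)))
  have h10 := norm_add_mul_sq_le (conj (α (1, 0))) (conj (γ (0, 0))) (conj (α (1, 1))) (conj (γ (0, 1)))
  have h11 := norm_add_mul_sq_le (conj (α (1, 0))) (conj (γ (1, 0))) (conj (α (1, 1))) (conj (γ (1, 1)))
  simp only [Complex.norm_conj] at h00 h01 h10 h11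
  nlinarith [h00, h01, h10, h11, sq_nonneg ‖α (0,0)‖, sq_nonneg ‖α (0,1)‖, sq_nonneg ‖α (1,0)‖,
    sq_nonneg ‖α (1,1)‖, sq_nonneg ‖γ (0,0)‖, sq_nonneg ‖γ (0,1)‖, sq_nonneg ‖γ (1,0)‖, sq_nonneg ‖γ (1,1)‖]

/-- The `(b,c)`-double contraction of `T₂`: `Σ_a ‖Σ_b conj(β b) cC γ T₂ a b‖² ≤ ‖β‖²‖γ‖²` (Cauchy–Schwarz over `μ`). -/
theorem sum_norm_cBC_T₂_le (β γ : P 2 → ℂ) :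
    ∑ a, ‖∑ b, conj (β b) * cC γ T₂ a b‖ ^ 2 ≤ (∑ b, ‖β b‖ ^ 2) * ∑ c, ‖γ c‖ ^ 2 := by
  simp only [cC_T₂, Fintype.sum_prod_type, Fin.sum_univ_two, Fin.isValue]
  simp only [Fin.isValue, ↓reduceIte, Fin.one_eq_zero_iff, OfNat.ofNat_ne_one, Fin.zero_eq_one_iff,
    mul_zero, add_zero, zero_add]
  have h00 := norm_add_mul_sq_le (conj (β (0, 0))) (conj (γ (0, 0))) (conj (β (0, 1))) (conj (γ (1, 0)))
  have h01 := norm_add_mul_sq_le (conj (β (0, 0))) (conj (γ (0, 1))) (conj (β (0, 1))) (conj (γ (1, 1)))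
  have h10 := norm_add_mul_sq_le (conj (β (1, 0))) (conj (γ (0, 0))) (conj (β (1, 1))) (conj (γ (1, 0)))
  have h11 := norm_add_mul_sq_le (conj (β (1, 0))) (conj (γ (0, 1))) (conj (β (1, 1))) (conj (γ (1, 1)))
  simp only [Complex.norm_conj] at h00 h01 h10 h11
  nlinarith [h00, h01, h10, h11, sq_nonneg ‖β (0,0)‖, sq_nonneg ‖β (0,1)‖, sq_nonneg ‖β (1,0)‖,
    sq_nonneg ‖β (1,1)‖, sq_nonneg ‖γ (0,0)‖, sq_nonneg ‖γ (0,1)‖, sq_nonneg ‖γ (1,0)‖, sq_nonneg ‖γ (1,1)‖]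

/-! ## Two deficient slots in positions `(a,c)` and `(b,c)` -/

/-- squared norm of `(P_{α⊥} ⊗ 1 ⊗ P_{γ⊥}) T₂` is at most `5`. -/
theorem nsq_dC_dA_T₂_le (α γ : P 2 → ℂ) (hα : ∑ i, ‖α i‖ ^ 2 = 1) (hγ : ∑ i, ‖γ i‖ ^ 2 = 1) :
    nsq (dC γ (dA α T₂)) ≤ 5 := by
  have hw := sum_norm_cAC_T₂_le α γ
  rw [nsq_dC γ hγ, nsq_dA α hα, nsq_T₂, sum_norm_cA_T₂, sum_norm_cC_dA α hα, sum_norm_cC_T₂, hα, hγ]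
  rw [hα, hγ] at hw
  linarith

/-- squared norm of `(1 ⊗ P_{β⊥} ⊗ P_{γ⊥}) T₂` is at most `5`. -/
theorem nsq_dC_dB_T₂_le (β γ : P 2 → ℂ) (hβ : ∑ i, ‖β i‖ ^ 2 = 1) (hγ : ∑ i, ‖γ i‖ ^ 2 = 1) :
    nsq (dC γ (dB β T₂)) ≤ 5 := by
  have hw := sum_norm_cBC_T₂_le β γ
  rw [nsq_dC γ hγ, nsq_dB β hβ, nsq_T₂, sum_norm_cB_T₂, sum_norm_cC_dB β hβ, sum_norm_cC_T₂, hβ, hγ]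
  rw [hβ, hγ] at hw
  linarith

/-- **Two deficient slots `(a,c)`**: `|⟨S,⟨2,2,2⟩⟩|² ≤ 5‖S‖²` (any rank). -/
theorem overlap_sq_le_five_of_annihilated_ac (S : P 2 → P 2 → P 2 → ℂ) (α γ : P 2 → ℂ)
    (hα : ∑ i, ‖α i‖ ^ 2 = 1) (hγ : ∑ i, ‖γ i‖ ^ 2 = 1)
    (hSa : ∀ b c, ∑ a, α a * S a b c = 0) (hSc : ∀ a b, ∑ c, γ c * S a b c = 0) :
    ‖overlap S‖ ^ 2 ≤ 5 * normSq S := by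
  have hp : overlap S = pair S (dC γ (dA α T₂)) := by
    rw [pair_dC γ hSc, pair_dA α hSa, pair_T₂]
  rw [hp]
  calc ‖pair S (dC γ (dA α T₂))‖ ^ 2 ≤ nsq S * nsq (dC γ (dA α T₂)) := norm_pair_sq_le _ _
    _ ≤ nsq S * 5 := mul_le_mul_of_nonneg_left (nsq_dC_dA_T₂_le α γ hα hγ) (nsq_nonneg S)
    _ = 5 * normSq S := by rw [nsq_eq_normSq, mul_comm]

/-- **Two deficient slots `(b,c)`**: `|⟨S,⟨2,2,2⟩⟩|² ≤ 5‖S‖²` (any rank). -/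
theorem overlap_sq_le_five_of_annihilated_bc (S : P 2 → P 2 → P 2 → ℂ) (β γ : P 2 → ℂ)
    (hβ : ∑ i, ‖β i‖ ^ 2 = 1) (hγ : ∑ i, ‖γ i‖ ^ 2 = 1)
    (hSb : ∀ a c, ∑ b, β b * S a b c = 0) (hSc : ∀ a b, ∑ c, γ c * S a b c = 0) :
    ‖overlap S‖ ^ 2 ≤ 5 * normSq S := by
  have hp : overlap S = pair S (dC γ (dB β T₂)) := by
    rw [pair_dC γ hSc, pair_dB β hSb, pair_T₂]
  rw [hp]
  calc ‖pair S (dC γ (dB β T₂))‖ ^ 2 ≤ nsq S * nsq (dC γ (dB β T₂)) := norm_pair_sq_le _ _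
    _ ≤ nsq S * 5 := mul_le_mul_of_nonneg_left (nsq_dC_dB_T₂_le β γ hβ hγ) (nsq_nonneg S)
    _ = 5 * normSq S := by rw [nsq_eq_normSq, mul_comm]

/-! ## Sums of triads with two deficient factor families -/

/-- A functional annihilating every `a`-factor annihilates slot `a` of the sum of triads. -/
theorem annihilated_a_of_triads {r : ℕ} (x y z : Fin r → P 2 → ℂ) (α : P 2 → ℂ)
    (hx : ∀ l, ∑ a, α a * x l a = 0) (b c : P 2) :
    ∑ a, α a * (∑ l, triad (x l) (y l) (z l)) a b c = 0 := by
  have h : ∀ a, α a * (∑ l, triad (x l) (y l) (z l)) a b c = ∑ l, (α a * x l a) * (y l b * z l c) := by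
    intro a
    rw [Finset.sum_apply, Finset.sum_apply, Finset.sum_apply, Finset.mul_sum]
    exact Finset.sum_congr rfl fun l _ => by rw [triad_apply]; ring
  simp_rw [h]
  rw [Finset.sum_comm]
  exact Finset.sum_eq_zero fun l _ => by rw [← Finset.sum_mul, hx l, zero_mul]

/-- A functional annihilating every `b`-factor annihilates slot `b` of the sum of triads. -/
theorem annihilated_b_of_triads {r : ℕ} (x y z : Fin r → P 2 → ℂ) (β : P 2 → ℂ)
    (hy : ∀ l, ∑ b, β b * y l b = 0) (a c : P 2) :
    ∑ b, β b * (∑ l, triad (x l) (y l) (z l)) a b c = 0 := by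
  have h : ∀ b, β b * (∑ l, triad (x l) (y l) (z l)) a b c = ∑ l, (β b * y l b) * (x l a * z l c) := by
    intro b
    rw [Finset.sum_apply, Finset.sum_apply, Finset.sum_apply, Finset.mul_sum]
    exact Finset.sum_congr rfl fun l _ => by rw [triad_apply]; ring
  simp_rw [h]
  rw [Finset.sum_comm]
  exact Finset.sum_eq_zero fun l _ => by rw [← Finset.sum_mul, hy l, zero_mul]

/-- A functional annihilating every `c`-factor annihilates slot `c` of the sum of triads. -/
theorem annihilated_c_of_triads {r : ℕ} (x y z : Fin r → P 2 → ℂ) (γ : P 2 → ℂ)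
    (hz : ∀ l, ∑ c, γ c * z l c = 0) (a b : P 2) :
    ∑ c, γ c * (∑ l, triad (x l) (y l) (z l)) a b c = 0 := by
  have h : ∀ c, γ c * (∑ l, triad (x l) (y l) (z l)) a b c = ∑ l, (γ c * z l c) * (x l a * y l b) := by
    intro c
    rw [Finset.sum_apply, Finset.sum_apply, Finset.sum_apply, Finset.mul_sum]
    exact Finset.sum_congr rfl fun l _ => by rw [triad_apply]; ring
  simp_rw [h]
  rw [Finset.sum_comm]
  exact Finset.sum_eq_zero fun l _ => by rw [← Finset.sum_mul, hz l, zero_mul]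

/-- **Sums of triads with two deficient factor families** (any number `r` of triads, any two of the three slots):
`|⟨S,⟨2,2,2⟩⟩|² ≤ 5‖S‖²`. -/
theorem overlap_sq_le_five_of_two_deficient {r : ℕ} (x y z : Fin r → P 2 → ℂ)
    (h : ((∃ α : P 2 → ℂ, (∑ i, ‖α i‖ ^ 2 = 1) ∧ ∀ l, ∑ a, α a * x l a = 0) ∧
          (∃ β : P 2 → ℂ, (∑ i, ‖β i‖ ^ 2 = 1) ∧ ∀ l, ∑ b, β b * y l b = 0)) ∨
      ((∃ α : P 2 → ℂ, (∑ i, ‖α i‖ ^ 2 = 1) ∧ ∀ l, ∑ a, α a * x l a = 0) ∧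
          (∃ γ : P 2 → ℂ, (∑ i, ‖γ i‖ ^ 2 = 1) ∧ ∀ l, ∑ c, γ c * z l c = 0)) ∨
      ((∃ β : P 2 → ℂ, (∑ i, ‖β i‖ ^ 2 = 1) ∧ ∀ l, ∑ b, β b * y l b = 0) ∧
          (∃ γ : P 2 → ℂ, (∑ i, ‖γ i‖ ^ 2 = 1) ∧ ∀ l, ∑ c, γ c * z l c = 0))) :
    ‖overlap (∑ l, triad (x l) (y l) (z l))‖ ^ 2 ≤ 5 * normSq (∑ l, triad (x l) (y l) (z l)) := by
  rcases h with ⟨⟨α, hα, hx⟩, ⟨β, hβ, hy⟩⟩ | ⟨⟨α, hα, hx⟩, ⟨γ, hγ, hz⟩⟩ | ⟨⟨β, hβ, hy⟩, ⟨γ, hγ, hz⟩⟩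
  · exact overlap_sq_le_five_of_annihilated_ab _ α β hα hβ (annihilated_a_of_triads x y z α hx)
      (annihilated_b_of_triads x y z β hy)
  · exact overlap_sq_le_five_of_annihilated_ac _ α γ hα hγ (annihilated_a_of_triads x y z α hx)
      (annihilated_c_of_triads x y z γ hz)
  · exact overlap_sq_le_five_of_annihilated_bc _ β γ hβ hγ (annihilated_b_of_triads x y z β hy)
      (annihilated_c_of_triads x y z γ hz)

/-! ## When is a family deficient: fewer than four vectors, or four dependent ones -/

/-- Fewer than `4 = dim ℂ^{2×2}` vectors are always deficient (rank–nullity and normalisation; cf.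
`FreeUnitProduct.exists_unit_orth`). -/
theorem deficient_of_card_lt {σ : Type} [Fintype σ] (hσ : Fintype.card σ < 4) (x : σ → P 2 → ℂ) :
    ∃ α : P 2 → ℂ, (∑ i, ‖α i‖ ^ 2 = 1) ∧ ∀ l, ∑ a, α a * x l a = 0 := by
  have hlt : Module.finrank ℂ (σ → ℂ) < Module.finrank ℂ (P 2 → ℂ) := by
    rw [Module.finrank_fintype_fun_eq_card, Module.finrank_fintype_fun_eq_card]
    simpa [P, Fintype.card_prod, Fintype.card_fin] using hσ
  obtain ⟨p₀, hp₀, hp₀ne⟩ := Submodule.exists_mem_ne_zero_of_ne_bot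
    (LinearMap.ker_ne_bot_of_finrank_lt (f := Matrix.mulVecLin (Matrix.of x)) hlt)
  have hker : ∀ l, ∑ a, x l a * p₀ a = 0 := fun l => congr_fun (LinearMap.mem_ker.1 hp₀) l
  have hpos : 0 < ∑ a, ‖p₀ a‖ ^ 2 := by
    obtain ⟨a, ha⟩ : ∃ a, p₀ a ≠ 0 := by
      by_contra h
      push Not at h
      exact hp₀ne (funext h)
    exact lt_of_lt_of_le (by positivity) (Finset.single_le_sum (f := fun a => ‖p₀ a‖ ^ 2)
      (fun i _ => by positivity) (Finset.mem_univ a))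
  set N : ℝ := Real.sqrt (∑ a, ‖p₀ a‖ ^ 2) with hN
  have hNpos : 0 < N := Real.sqrt_pos.2 hpos
  have hN2 : N ^ 2 = ∑ a, ‖p₀ a‖ ^ 2 := Real.sq_sqrt hpos.le
  refine ⟨fun a => p₀ a / N, ?_, fun l => ?_⟩
  · have h : ∀ a, ‖p₀ a / (N : ℂ)‖ ^ 2 = ‖p₀ a‖ ^ 2 / N ^ 2 := fun a => by
      rw [norm_div, Complex.norm_real, Real.norm_of_nonneg hNpos.le, div_pow]
    simp only [h]
    rw [← Finset.sum_div, ← hN2]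
    exact div_self (pow_pos hNpos 2).ne'
  · have h : ∑ a, p₀ a / N * x l a = (∑ a, x l a * p₀ a) / N := by
      rw [Finset.sum_div]
      exact Finset.sum_congr rfl fun a _ => by ring
    rw [h, hker l, zero_div]

/-- Four linearly DEPENDENT vectors of `ℂ^{2×2}` are deficient. -/
theorem deficient_of_not_linearIndependent (x : Fin 4 → P 2 → ℂ) (hx : ¬ LinearIndependent ℂ x) :
    ∃ α : P 2 → ℂ, (∑ i, ‖α i‖ ^ 2 = 1) ∧ ∀ l, ∑ a, α a * x l a = 0 := by
  obtain ⟨g, hg, i₀, hi₀⟩ := Fintype.not_linearIndependent_iff.1 hx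
  -- the other three vectors are deficient
  obtain ⟨α, hα, hα'⟩ := deficient_of_card_lt (σ := Fin 3) (by simp) (fun j => x (i₀.succAbove j))
  refine ⟨α, hα, fun l => ?_⟩
  -- `α` also annihilates `x i₀`, through the relation
  have hrel : ∀ a, ∑ i, g i * x i a = 0 := fun a => by
    have := congr_fun hg a
    simpa [Finset.sum_apply, Pi.smul_apply, smul_eq_mul] using this
  have h0 : g i₀ * ∑ a, α a * x i₀ a = 0 := by
    have h1 : ∑ a, α a * ∑ i, g i * x i a = 0 := by
      simp_rw [hrel]; simp
    have h2 : ∑ a, α a * ∑ i, g i * x i a = ∑ i, g i * ∑ a, α a * x i a := by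
      simp_rw [Finset.mul_sum]
      rw [Finset.sum_comm]
      exact Finset.sum_congr rfl fun i _ => Finset.sum_congr rfl fun a _ => by ring
    rw [h2, Fin.sum_univ_succAbove _ i₀] at h1
    simp only [hα', mul_zero, Finset.sum_const_zero, add_zero] at h1
    exact h1
  have hx0 : ∑ a, α a * x i₀ a = 0 := by
    rcases mul_eq_zero.1 h0 with h | h
    · exact absurd h hi₀
    · exact h
  by_cases hl : l = i₀
  · rw [hl]; exact hx0
  · obtain ⟨j, hj⟩ := Fin.exists_succAbove_eq hl
    rw [← hj]; exact hα' j

/-! ## Consequences for the rungs of the law -/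

/-- **`M(2,3) ≤ 5` unconditionally** (every factor family of a rank-`≤ 3` tensor is deficient; the law's rank-3 rung asks
for `4`, see the three-slot bound). -/
theorem overlap_sq_le_five_of_rank_le_three (S : P 2 → P 2 → P 2 → ℂ) (hS : tensorRank S ≤ 3) :
    ‖overlap S‖ ^ 2 ≤ 5 * normSq S := by
  obtain ⟨x, y, z, rfl⟩ := exists_eq_sum_triad_of_tensorRank_le hS
  exact overlap_sq_le_five_of_two_deficient x y z
    (Or.inl ⟨deficient_of_card_lt (by simp) x, deficient_of_card_lt (by simp) y⟩)

/-- **The rank-4 rung `M(2,4) ≤ 5` holds off the doubly-concise stratum.** A tensor of rank `≤ 4` written with four triads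
whose factor families are NOT linearly independent in at least two of the three slots satisfies `|⟨S,⟨2,2,2⟩⟩|² ≤ 5‖S‖²`. -/
theorem rung24_of_two_dependent (x y z : Fin 4 → P 2 → ℂ)
    (h : (¬ LinearIndependent ℂ x ∧ ¬ LinearIndependent ℂ y) ∨ (¬ LinearIndependent ℂ x ∧ ¬ LinearIndependent ℂ z) ∨
      (¬ LinearIndependent ℂ y ∧ ¬ LinearIndependent ℂ z)) :
    ‖overlap (∑ l, triad (x l) (y l) (z l))‖ ^ 2 ≤ 5 * normSq (∑ l, triad (x l) (y l) (z l)) := by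
  refine overlap_sq_le_five_of_two_deficient x y z ?_
  rcases h with ⟨hx, hy⟩ | ⟨hx, hz⟩ | ⟨hy, hz⟩
  · exact Or.inl ⟨deficient_of_not_linearIndependent x hx, deficient_of_not_linearIndependent y hy⟩
  · exact Or.inr (Or.inl ⟨deficient_of_not_linearIndependent x hx, deficient_of_not_linearIndependent z hz⟩)
  · exact Or.inr (Or.inr ⟨deficient_of_not_linearIndependent y hy, deficient_of_not_linearIndependent z hz⟩)

/-- **Reduction of the rank-4 rung to the doubly-concise stratum.** `M(2,4) ≤ 5` (the third conjunct of
`TwoIff.lawAtTwo_iff`, the only `n = 2` content of `LinearDefectLaw` besides `SevenEighthsLaw` and `SixEighthsAtFive`)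
follows as soon as it holds for sums of four triads whose factor families are bases of `ℂ^{2×2}` in at least two slots. -/
theorem rung24_of_doublyConcise
    (h : ∀ x y z : Fin 4 → P 2 → ℂ,
      ((LinearIndependent ℂ x ∧ LinearIndependent ℂ y) ∨ (LinearIndependent ℂ x ∧ LinearIndependent ℂ z) ∨
        (LinearIndependent ℂ y ∧ LinearIndependent ℂ z)) →
      ‖overlap (∑ l, triad (x l) (y l) (z l))‖ ^ 2 ≤ 5 * normSq (∑ l, triad (x l) (y l) (z l))) :
    ∀ S : Fin 2 × Fin 2 → Fin 2 × Fin 2 → Fin 2 × Fin 2 → ℂ, tensorRank S ≤ 4 →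
      ‖∑ a, ∑ b, ∑ c, S a b c * matMulTensor ℂ 2 2 2 a b c‖ ^ 2 ≤ 5 * ∑ a, ∑ b, ∑ c, ‖S a b c‖ ^ 2 := by
  intro S hS
  obtain ⟨x, y, z, rfl⟩ := exists_eq_sum_triad_of_tensorRank_le hS
  show ‖overlap _‖ ^ 2 ≤ 5 * normSq _
  by_cases hx : LinearIndependent ℂ x <;> by_cases hy : LinearIndependent ℂ y <;>
    by_cases hz : LinearIndependent ℂ z
  · exact h x y z (Or.inl ⟨hx, hy⟩)
  · exact h x y z (Or.inl ⟨hx, hy⟩)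
  · exact h x y z (Or.inr (Or.inl ⟨hx, hz⟩))
  · exact rung24_of_two_dependent x y z (Or.inr (Or.inr ⟨hy, hz⟩))
  · exact h x y z (Or.inr (Or.inr ⟨hy, hz⟩))
  · exact rung24_of_two_dependent x y z (Or.inr (Or.inl ⟨hx, hz⟩))
  · exact rung24_of_two_dependent x y z (Or.inl ⟨hx, hy⟩)
  · exact rung24_of_two_dependent x y z (Or.inl ⟨hx, hy⟩)

/-- **Registered stub `stub_rung24OfDoublyConcise`** (raw form of `rung24_of_doublyConcise`). -/
theorem stub_rung24OfDoublyConcise : (∀ x y z : Fin 4 → Fin 2 × Fin 2 → ℂ, ((LinearIndependent ℂ x ∧ LinearIndependent ℂ y) ∨ (LinearIndependent ℂ x ∧ LinearIndependent ℂ z) ∨ (LinearIndependent ℂ y ∧ LinearIndependent ℂ z)) → ‖∑ a, ∑ b, ∑ c, (∑ l, triad (x l) (y l) (z l)) a b c * matMulTensor ℂ 2 2 2 a b c‖ ^ 2 ≤ 5 * ∑ a, ∑ b, ∑ c, ‖(∑ l, triad (x l) (y l) (z l)) a b c‖ ^ 2) → ∀ S : Fin 2 × Fin 2 → Fin 2 ×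 Fin 2 → Fin 2 × Fin 2 → ℂ, tensorRank S ≤ 4 → ‖∑ a, ∑ b, ∑ c, S a b c * matMulTensor ℂ 2 2 2 a b c‖ ^ 2 ≤ 5 * ∑ a, ∑ b, ∑ c, ‖S a b c‖ ^ 2 :=
  fun h => rung24_of_doublyConcise h

end Summit.MatrixMultiplication.MatrixMultiplication.Theorems.LinearDefectLaw.SlotDeflation

end
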